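import Summits.Langlands.Langlands.Theses.DyadicOddResidue
import Summits.Langlands.Langlands.Theorems.DyadicDihedralFM.Negative.IrreducibleRedundant
import Summits.Langlands.Langlands.Theorems.ReducibleOrdinaryProModular.Negative.LevelAndRamification
import Literature.NumberTheory.Automorphic.PadicallyAutomorphicDetComplexConjugation

/-!
# Anatomy of the crux `DihedralProModularityCore` (stmt-Langlands-18168, route `DyadicOddResidue`)
# — refuter birth vetting, negative-lane helper lemmas (sorry-free; they do NOT refute the crux)

* `isOdd_and_ae_isUnramifiedAt_of_conclusion` — the CONCLUSION of the crux
  (`∃ 𝒰 : TameLevel 2 ℚ 2, 𝒰.IsPadicallyAutomorphic ρ`, "2-adically automorphic of some tame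
  level") already forces two of its hypotheses: `ρ.IsOdd` (tree theorem
  `BigHeckeGLn.TameLevel.IsPadicallyAutomorphic.isOdd`, valid at every `p`, here `p = 2`) and
  `∀ᶠ v, ρ.IsUnramifiedAt v` (landed `ae_isUnramifiedAt_of_isPadicallyAutomorphic`).  Hence the
  hypotheses `hodd`, `hunr` are NECESSARY: dropping either can only add counterexamples (an even or
  an infinitely ramified `ρ` in the sector), never make the statement easier; and no junk point of
  the big Hecke algebra can serve an even `ρ`.
* `core_iff_without_isIrreducible` — the hypothesis `ρ.toGaloisRep.IsIrreducible` is REDUNDANT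
  given `ρ.IsResiduallyAbsIrreducible` (landed `isIrreducible_of_isResiduallyAbsIrreducible`,
  Burnside, rank `2 > 0`); provers may assume it for free, no refutation can use a reducible `ρ`.
-/

set_option linter.dupNamespace false -- `Summit.Langlands.Langlands` is the mandated namespace

namespace Summit.Langlands.Langlands.Theorems.DihedralProModularityCore.Negative

open Summit.Langlands.Langlands.Theses.DyadicOddResidue
open Literature.NumberTheory.GaloisRepresentations Literature.NumberTheory.Automorphic
open IsDedekindDomain Filter

/-- **The conclusion forces oddness and a.e.-unramifiedness** (`p = 2`, `n = 2`, `K = ℚ`):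
a `2`-adically automorphic `ρ : Γ_ℚ → GL₂(ℚ̄₂)` of some tame level is odd and unramified at all
but finitely many places. [folklore] -/
theorem isOdd_and_ae_isUnramifiedAt_of_conclusion
    (ρ : FramedGaloisRep ℚ (PadicAlgCl 2) 2)
    (h : ∃ 𝒰 : BigHeckeGLn.TameLevel 2 ℚ 2, 𝒰.IsPadicallyAutomorphic ρ) :
    ρ.IsOdd ∧ ∀ᶠ v : HeightOneSpectrum (NumberField.RingOfIntegers ℚ) in cofinite,
      ρ.IsUnramifiedAt v := by
  obtain ⟨𝒰, h𝒰⟩ := h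
  exact ⟨BigHeckeGLn.TameLevel.IsPadicallyAutomorphic.isOdd 𝒰 h𝒰,
    ReducibleOrdinaryProModular.Negative.ae_isUnramifiedAt_of_isPadicallyAutomorphic 𝒰 ρ h𝒰⟩

/-- **`hirr` is redundant in `DihedralProModularityCore`.** The crux is equivalent to the
statement obtained by deleting the binder `ρ.toGaloisRep.IsIrreducible →` (everything else
verbatim): forward direction by `isIrreducible_of_isResiduallyAbsIrreducible` (rank `2 > 0`),
converse by weakening. [folklore] -/
theorem core_iff_without_isIrreducible :
    DihedralProModularityCore ↔
    (∀ (ρ : Literature.NumberTheory.GaloisRepresentations.FramedGaloisRep ℚ (PadicAlgCl 2) 2), ρ.IsResiduallyAbsIrreducible → IsSolvable ρ.residualRep.range → ρ.IsOdd → (∀ᶠ v : IsDedekindDomain.HeightOneSpectrum (NumberField.RingOfIntegers ℚ) in Filter.cofinite, ρ.IsUnramifiedAt v) → (∀ (v : IsDedekindDomain.HeightOneSpectrum (NumberField.RingOfIntegers ℚ)) (hv : ((2 : ℕ) : NumberField.RingOfIntegers ℚ) ∈ v.asIdeal), (Literature.NumberTheory.PAdicHodge.fontainePstAdicCompletion v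 2 hv).IsDeRhamFramed (ρ.toLocal v) ∧ ∀ τ : v.adicCompletion ℚ →+* PadicAlgCl 2, Continuous τ → (ρ.labelledHodgeTateWeightsAt v (Literature.NumberTheory.PAdicHodge.fontainePstAdicCompletion v 2 hv).algebra (Literature.NumberTheory.PAdicHodge.fontainePstAdicCompletion v 2 hv).𝔅 τ).Nodup) → ¬ (∃ (χ₀ : Field.absoluteGaloisGroup ℚ →ₜ* (PadicAlgCl 2)ˣ) (a : ℤ) (m : ℕ), (∀ σ, χ₀ σ = Literature.NumberTheory.GaloisRepresentations.cyclotomicPadicAlgCl ℚ 2 σ ^ a) ∧ 0 < m ∧ ∀ (v : IsDedekindDomain.HeightOneSpectrum (NumberField.RingOfIntegers ℚ)) (hv : ((2 : ℕ) : NumberField.RingOfIntegers ℚ) ∈ v.asIdeal), Literature.NumberTheory.GaloisRepresentations.FramedGaloisRep.IsOrdinaryOfWeightAt 2 (Literature.NumberTheory.GaloisRepresentations.FramedRep.twist ρ χ₀) v 2 m ∧ (Literature.NumberTheory.PAdicHodge.fontainePstAdicCompletion v 2 hv).IsDeRhamFramed (Literature.NumberTheory.GaloisRepresentations.FramedGaloisRep.toLocal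 v (Literature.NumberTheory.GaloisRepresentations.FramedRep.twist ρ χ₀)) ∧ ∀ r, (Literature.NumberTheory.PAdicHodge.fontainePstAdicCompletion v 2 hv).IsWeilDeligneOf (Literature.NumberTheory.GaloisRepresentations.FramedGaloisRep.toLocal v (Literature.NumberTheory.GaloisRepresentations.FramedRep.twist ρ χ₀)) r → r.N = 0) → ¬ (Literature.NumberTheory.GaloisRepresentations.AllenConditionFive ρ.residualRep ∧ ∃ (χ₀ : Field.absoluteGaloisGroup ℚ →ₜ* (PadicAlgCl 2)ˣ) (a : ℤ) (k m : ℕ), (∀ σ, χ₀ σ = Literature.NumberTheory.GaloisRepresentations.cyclotomicPadicAlgCl ℚ 2 σ ^ a) ∧ 2 ≤ k ∧ 0 < m ∧ (∀ v : IsDedekindDomain.HeightOneSpectrum (NumberField.RingOfIntegers ℚ), ((2 : ℕ) : NumberField.RingOfIntegers ℚ) ∈ v.asIdeal → Literature.NumberTheory.GaloisRepresentations.FramedGaloisRep.IsOrdinaryOfWeightAt 2 (Literature.NumberTheory.GaloisRepresentations.FramedRep.twist ρ χ₀) v k m) ∧ ∃ n : ℕ, 0 < n ∧ ∀ σ, (Literature.NumberTheory.GaloisRepresentations.FramedRep.det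 (Literature.NumberTheory.GaloisRepresentations.FramedRep.twist ρ χ₀) σ * (Literature.NumberTheory.GaloisRepresentations.cyclotomicPadicAlgCl ℚ 2 σ ^ ((k : ℤ) - 1))⁻¹) ^ n = 1) → ∃ 𝒰 : Literature.NumberTheory.Automorphic.BigHeckeGLn.TameLevel 2 ℚ 2, 𝒰.IsPadicallyAutomorphic ρ) := by
  constructor
  · intro h ρ hres hsol hodd hunr hdR hT hA
    exact h ρ hres hsol
      (DyadicDihedralFM.Negative.isIrreducible_of_isResiduallyAbsIrreducible two_pos ρ hres)
      hodd hunr hdR hT hA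
  · intro h ρ hres hsol _ hodd hunr hdR hT hA
    exact h ρ hres hsol hodd hunr hdR hT hA

end Summit.Langlands.Langlands.Theorems.DihedralProModularityCore.Negative
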